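import Summits.BirchSwinnertonDyer.BirchSwinnertonDyer.Theorems.BiquadraticEisensteinDescentHeegnerTwistCouplingInSupplySymbolicMonskyOddKernelParity
import HarnessLib

set_option linter.dupNamespace false -- `Summit.BirchSwinnertonDyer.BirchSwinnertonDyer.Theorems.…` (summit = sub)
set_option autoImplicit false

/-!
# Crux `HeegnerTwistCouplingInSupply` (stmt-BirchSwinnertonDyer-21381) — the ODD one-stage door on the family `P_b ≡ 1, 5 (mod 8)`
# (`n₀ ≡ 5 (mod 8)`, no prime `≡ 3 (mod 4)`): OPEN IFF `dim ker L ≤ τ₀`, and then `δ = 1` works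

Route `BiquadraticEisensteinDescent` (cell `pub/bsd-wall`, width seat `bsd-wall-cm-bed-w3` g24; `--supports` 21381, helper). THEOREM B (p745248)
settles every odd base with exactly one prime `≡ 3 (mod 4)`; the family with NO prime `≡ 3 (mod 4)` — all `P_b ≡ 1, 5 (mod 8)`, an odd number
`≡ 5 (mod 8)`, i.e. the classical `n₀ ≡ 5 (mod 8)` bases with all primes `≡ 1 (mod 4)` — is outside it. Here the symbol matrix is symmetric
(`Lᵀ = L`, `sum_lap_eq_zero_of_negNegOne_false`) and the virtual kernel is `𝒦 = {(x, y) : L x = D_d y, L y = 0}`: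
* ★★ `augKernel_one_hypotheses_of_negNegOne_false` — if the horizontal pairs `(x, 0) ∈ 𝒦` (= `ker L × 0`) span `≤ τ₀ = (dim 𝒦 + 1)/2` dimensions,
  then `δ = 1`, `τ = τ₀` satisfy ALL FIVE hypotheses of THEOREM A (`exists_patternFree_design`, p742384): `(1,1) ∉ 𝒦` and `{(x,0)} ∩ 𝒦⁺(1) = ker L × 0`
  because `d ∉ im L` (column sums); the `0×V` and diagonal sections are `E ⊕ ⟨1⟩`, `E = ker L ∩ ker D_d`, of dimension `≤ τ₀` because `E × 0`,
  `⟨(1,0)⟩` and `0 × E` sit independently in `𝒦`; `hdim` by the kernel parity (p752042);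
* ★★★ `exists_patternFree_design_of_negNegOne_false` — hence a pattern-free Heegner recipe with `τ₀ + 1` auxiliary primes;
* ★★★ `odd_door_iff_of_negNegOne_false` — SOME `(δ, τ)` satisfies the hypotheses of THEOREM A IFF `dim(𝒦 ∩ (V×0)) ≤ τ₀` (then `δ = 1`).
Numerics (memo EVEN-EXCEPTIONAL-CLASS-w3g24 §2d): 39 299 sampled bases of the family (K ≤ 9): `δ = 1` good in 31 129, and the 8 170 failures are
exactly the bases with `dim(𝒦 ∩ V×0) > τ₀`.

HONEST FRAMING: RUNG-LEVEL corner layer (odd congruent `j = 1728` families `E_{n₀}`); statements about Monsky matrices; instances of the crux still need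
located primes and the print input; the crux as stated (C⁺), its registered stubs and BSD are NOT touched; nothing is closed. THEOREMS ONLY.
Reference: [HeathBrown1994] D. R. Heath-Brown, Invent. Math. 118 (1994) 331–370, appendix (Monsky), typescript pp. 39–41.
-/

namespace Summit.BirchSwinnertonDyer.BirchSwinnertonDyer.Theorems.SymbolicMonsky

section OddClassesOneFive

open Module Matrix

variable {k : ℕ} (base : SymbData (k + 1))

/-- Column sums of the Laplacian vanish when no base prime is `≡ 3 (mod 4)`: `Σ_i Σ_j [(P_j/P_i) = −1](y_j + y_i) = 0` (the symbol is then symmetric). -/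
private theorem sum_lap_eq_zero_of_negNegOne_false (hm : ∀ b, negNegOne (base.cls b) = false) (y : Fin (k + 1) → ZMod 2) :
    (∑ i, ∑ j, bz (base.neg i j) * (y j + y i)) = 0 := by
  have h2 : ∀ x : ZMod 2, x + x = 0 := by decide
  have e1 : (∑ i, ∑ j, bz (base.neg i j) * (y j + y i)) = ∑ i, ∑ j, (bz (base.neg j i) + bz (base.neg i j)) * y i := by
    have : (∑ i, ∑ j, bz (base.neg i j) * (y j + y i)) = (∑ i, ∑ j, bz (base.neg i j) * y j) + ∑ i, ∑ j, bz (base.neg i j) * y i := by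
      rw [← Finset.sum_add_distrib]
      refine Finset.sum_congr rfl fun i _ => ?_
      rw [← Finset.sum_add_distrib]
      exact Finset.sum_congr rfl fun j _ => by ring
    rw [this, Finset.sum_comm, ← Finset.sum_add_distrib]
    refine Finset.sum_congr rfl fun i _ => ?_
    rw [← Finset.sum_add_distrib]
    exact Finset.sum_congr rfl fun j _ => by ring
  rw [e1]
  refine Finset.sum_eq_zero fun i _ => Finset.sum_eq_zero fun j _ => ?_
  by_cases hji : j = i
  · subst hji; linear_combination (h2 (bz (base.neg j j))) * y j
  · have hij : i ≠ j := fun h => hji h.symm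
    rw [base.bz_neg_swap hij, hm i]
    simp only [Bool.false_and, show bz false = (0 : ZMod 2) from rfl, add_zero]
    linear_combination (h2 (bz (base.neg i j))) * y i

/-- ★★ **Hypotheses of THEOREM A for `δ = 1` on the odd family `P_b ≡ 1, 5 (mod 8)`** (no prime `≡ 3 (mod 4)`; an odd number `≡ 5 (mod 8)`, so
`n₀ ≡ 5 (mod 8)`, root number `−1`): if the horizontal kernel pairs `(x, 0) ∈ 𝒦` span `≤ τ₀ = (dim 𝒦 + 1)/2` dimensions, then `(1,1) ∉ 𝒦`,
`dim 𝒦⁺(1) = 2τ₀`, and the three plane sections of `𝒦⁺(1) = 𝒦 ⊕ ⟨(1,1)⟩` have dimension `≤ τ₀` (they are `{(x,0) ∈ 𝒦} = ker L × 0`,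
`0 × (E ⊕ ⟨1⟩)`, `{(x,x) : x ∈ E ⊕ ⟨1⟩}` with `E = ker L ∩ ker D_d`). [cite: HeathBrown1994SelmerCongruentII, Appendix (Monsky), typescript pp. 39–41] -/
theorem augKernel_one_hypotheses_of_negNegOne_false (hm : ∀ b, negNegOne (base.cls b) = false)
    (hd : (∑ b, bz (negTwo (base.cls b))) = 1)
    (ha : finrank (ZMod 2) ↥(base.virtualKernel ⊓
      LinearMap.ker (LinearMap.snd (ZMod 2) (Fin (k + 1) → ZMod 2) (Fin (k + 1) → ZMod 2))) ≤
        (finrank (ZMod 2) ↥base.virtualKernel + 1) / 2) :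
    (((fun _ => (1 : ZMod 2)), fun _ => (1 : ZMod 2)) : (Fin (k + 1) → ZMod 2) × (Fin (k + 1) → ZMod 2)) ∉ base.virtualKernel ∧
      finrank (ZMod 2) ↥(base.augKernel (fun _ => 1)) = 2 * ((finrank (ZMod 2) ↥base.virtualKernel + 1) / 2) ∧
      finrank (ZMod 2) ↥(base.augKernel (fun _ => 1) ⊓
        LinearMap.ker (LinearMap.snd (ZMod 2) (Fin (k + 1) → ZMod 2) (Fin (k + 1) → ZMod 2))) ≤
          (finrank (ZMod 2) ↥base.virtualKernel + 1) / 2 ∧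
      finrank (ZMod 2) ↥(base.augKernel (fun _ => 1) ⊓
        LinearMap.ker (LinearMap.fst (ZMod 2) (Fin (k + 1) → ZMod 2) (Fin (k + 1) → ZMod 2))) ≤
          (finrank (ZMod 2) ↥base.virtualKernel + 1) / 2 ∧
      finrank (ZMod 2) ↥(base.augKernel (fun _ => 1) ⊓ LinearMap.ker (LinearMap.fst (ZMod 2) (Fin (k + 1) → ZMod 2) (Fin (k + 1) → ZMod 2) +
        LinearMap.snd (ZMod 2) (Fin (k + 1) → ZMod 2) (Fin (k + 1) → ZMod 2))) ≤
          (finrank (ZMod 2) ↥base.virtualKernel + 1) / 2 := by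
  have h2 : ∀ x : ZMod 2, x + x = 0 := by decide
  have hm0 : ∀ b, bz (negNegOne (base.cls b)) = 0 := fun b => by rw [hm b]; rfl
  have hroot : (∑ b, (bz (negNegOne (base.cls b)) + bz (negTwo (base.cls b)))) = 1 := by
    rw [Finset.sum_add_distrib, hd]; simp [hm0]
  obtain ⟨r, hr⟩ := odd_finrank_virtualKernel base hroot
  -- membership in `𝒦` (no prime ≡ 3 (mod 4)): `L x + D_d y = 0`, `L y = 0`
  have memK : ∀ p : (Fin (k + 1) → ZMod 2) × (Fin (k + 1) → ZMod 2), p ∈ base.virtualKernel ↔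
      (∀ i, (∑ j, bz (base.neg i j) * (p.1 j + p.1 i)) + bz (negTwo (base.cls i)) * p.2 i = 0) ∧
      (∀ i, (∑ j, bz (base.neg i j) * (p.2 j + p.2 i)) = 0) := by
    intro p
    rw [mem_virtualKernel_iff]
    simp only [hm0, zero_mul, add_zero, zero_add]
  set δ : Fin (k + 1) → ZMod 2 := fun _ => 1 with hδdef
  -- `d` is not identically zero and not in the image of `L`
  have hL1 : ∀ (x : Fin (k + 1) → ZMod 2) (γ : ZMod 2) (i : Fin (k + 1)),
      (∑ j, bz (base.neg i j) * ((x j + γ) + (x i + γ))) = ∑ j, bz (base.neg i j) * (x j + x i) :=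
    fun x γ i => Finset.sum_congr rfl fun j _ => by linear_combination (bz (base.neg i j)) * h2 γ
  have hnotim : ∀ x : Fin (k + 1) → ZMod 2, ¬ (∀ i, (∑ j, bz (base.neg i j) * (x j + x i)) = bz (negTwo (base.cls i))) := by
    intro x hx
    have hs := sum_lap_eq_zero_of_negNegOne_false base hm x
    rw [Finset.sum_congr rfl fun i _ => hx i, hd] at hs
    exact one_ne_zero hs
  -- legitimacy
  have hleg : ((δ, fun _ => (1 : ZMod 2)) : (Fin (k + 1) → ZMod 2) × (Fin (k + 1) → ZMod 2)) ∉ base.virtualKernel := by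
    intro h
    have hE1 := ((memK _).1 h).1
    apply hnotim (fun _ => 0)
    intro i
    have e := hE1 i
    simp only [hδdef, h2, mul_zero, Finset.sum_const_zero, zero_add, mul_one] at e
    simp only [h2, mul_zero, Finset.sum_const_zero]
    -- e : bz (negTwo (cls i)) = 0
    rw [e]
  -- the subspace `E ⊕ ⟨1⟩`, `E = ker L ∩ ker D_d`, sits in `𝒦` in two disjoint ways
  set Lm : Matrix (Fin (k + 1)) (Fin (k + 1)) (ZMod 2) := Matrix.of fun i j : Fin (k + 1) => bz (base.neg i j) +
      if i = j then (∑ l, bz (base.neg i l)) else 0 with hLm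
  have lap : ∀ (y : Fin (k + 1) → ZMod 2) i, (Lm *ᵥ y) i = ∑ j, bz (base.neg i j) * (y j + y i) := by
    intro y i
    simp only [hLm, mulVec, dotProduct, Matrix.of_apply]
    have e1 : (∑ j, (bz (base.neg i j) + if i = j then (∑ l, bz (base.neg i l)) else 0) * y j) =
        (∑ j, bz (base.neg i j) * y j) + ∑ j, (if i = j then (∑ l, bz (base.neg i l)) * y j else 0) := by
      rw [← Finset.sum_add_distrib]
      refine Finset.sum_congr rfl fun j _ => ?_
      split_ifs <;> ring
    have e2 : (∑ j, bz (base.neg i j) * (y j + y i)) = (∑ j, bz (base.neg i j) * y j) + (∑ l, bz (base.neg i l)) * y i := by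
      rw [Finset.sum_mul, ← Finset.sum_add_distrib]
      exact Finset.sum_congr rfl fun j _ => by ring
    rw [e1, Finset.sum_ite_eq, e2]
    simp only [Finset.mem_univ, if_true]
  set E : Submodule (ZMod 2) (Fin (k + 1) → ZMod 2) :=
    LinearMap.ker Lm.mulVecLin ⊓ LinearMap.ker (Matrix.diagonal fun i => bz (negTwo (base.cls i))).mulVecLin with hE
  have memE : ∀ y, y ∈ E ↔ (∀ i, (∑ j, bz (base.neg i j) * (y j + y i)) = 0) ∧ ∀ i, bz (negTwo (base.cls i)) * y i = 0 := by
    intro y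
    rw [hE, Submodule.mem_inf, LinearMap.mem_ker, LinearMap.mem_ker, mulVecLin_apply, mulVecLin_apply]
    constructor
    · rintro ⟨h1, h1'⟩
      exact ⟨fun i => by have := congrFun h1 i; rwa [lap] at this, fun i => by have := congrFun h1' i; rwa [mulVec_diagonal] at this⟩
    · rintro ⟨h1, h1'⟩
      exact ⟨funext fun i => by rw [lap]; exact h1 i, funext fun i => by rw [mulVec_diagonal]; exact h1' i⟩
  set E1 := E ⊔ Submodule.span (ZMod 2) {fun _ => (1 : ZMod 2)} with hE1
  have memE1 : ∀ y, y ∈ E1 → ∃ e ∈ E, ∃ γ : ZMod 2, y = fun b => e b + γ := by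
    intro y hy
    rw [hE1, Submodule.mem_sup] at hy
    obtain ⟨e, he, z, hz, rfl⟩ := hy
    obtain ⟨γ, rfl⟩ := Submodule.mem_span_singleton.1 hz
    exact ⟨e, he, γ, funext fun b => by simp⟩
  have hE1fin : finrank (ZMod 2) ↥E1 ≤ finrank (ZMod 2) ↥E + 1 := by
    refine (Submodule.finrank_add_le_finrank_add_finrank _ _).trans ?_
    have h1ne : (fun _ => (1 : ZMod 2)) ≠ (0 : Fin (k + 1) → ZMod 2) := by
      intro h; have := congrFun h 0; simp at this
    rw [finrank_span_singleton h1ne]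
  -- lower bound `2 dim E + 1 ≤ dim 𝒦`: `H1 = E1 × 0`, `H2 = 0 × E`
  have hlow : 2 * finrank (ZMod 2) ↥E + 1 ≤ finrank (ZMod 2) ↥base.virtualKernel := by
    set H1 := E1.map (LinearMap.inl (ZMod 2) (Fin (k + 1) → ZMod 2) (Fin (k + 1) → ZMod 2)) with hH1
    set H2 := E.map (LinearMap.inr (ZMod 2) (Fin (k + 1) → ZMod 2) (Fin (k + 1) → ZMod 2)) with hH2
    have h1le : H1 ≤ base.virtualKernel := by
      intro p hp
      obtain ⟨y, hy, rfl⟩ := Submodule.mem_map.1 hp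
      obtain ⟨e, he, γ, rfl⟩ := memE1 y hy
      obtain ⟨heL, heD⟩ := (memE e).1 he
      rw [memK]
      refine ⟨fun i => ?_, fun i => ?_⟩
      · simp only [LinearMap.inl_apply, Pi.zero_apply, mul_zero, add_zero]
        rw [hL1]; exact heL i
      · simp only [LinearMap.inl_apply, Pi.zero_apply, add_zero, mul_zero, Finset.sum_const_zero]
    have h2le : H2 ≤ base.virtualKernel := by
      intro p hp
      obtain ⟨y, hy, rfl⟩ := Submodule.mem_map.1 hp
      obtain ⟨heL, heD⟩ := (memE y).1 hy
      rw [memK]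
      refine ⟨fun i => ?_, fun i => ?_⟩
      · simp only [LinearMap.inr_apply, Pi.zero_apply, add_zero, mul_zero, Finset.sum_const_zero, zero_add]; exact heD i
      · simp only [LinearMap.inr_apply]; exact heL i
    have hdis : H1 ⊓ H2 = ⊥ := by
      rw [Submodule.eq_bot_iff]
      intro p hp
      obtain ⟨hp1, hp2⟩ := Submodule.mem_inf.1 hp
      obtain ⟨y, -, rfl⟩ := Submodule.mem_map.1 hp1
      obtain ⟨y', -, hy'⟩ := Submodule.mem_map.1 hp2
      have : y = 0 := by have := congrArg Prod.fst hy'; simpa using this.symm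
      rw [this]; rfl
    have h1E : (fun _ => (1 : ZMod 2)) ∉ E := by
      intro h
      have hD := ((memE _).1 h).2
      have : (∑ b, bz (negTwo (base.cls b))) = 0 := Finset.sum_eq_zero fun b _ => by have := hD b; simpa using this
      rw [hd] at this; exact one_ne_zero this
    have hE1eq : finrank (ZMod 2) ↥E1 = finrank (ZMod 2) ↥E + 1 := by
      have hdis1 : E ⊓ Submodule.span (ZMod 2) {fun _ => (1 : ZMod 2)} = ⊥ :=
        disjoint_iff.1 ((Submodule.disjoint_span_singleton).2 fun h => absurd h h1E)
      have e := Submodule.finrank_sup_add_finrank_inf_eq E (Submodule.span (ZMod 2) {fun _ => (1 : ZMod 2)})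
      have h1ne : (fun _ => (1 : ZMod 2)) ≠ (0 : Fin (k + 1) → ZMod 2) := by
        intro h; have := congrFun h 0; simp at this
      rw [hdis1, finrank_bot, add_zero, finrank_span_singleton h1ne] at e
      rw [hE1]; exact e
    have hsum := Submodule.finrank_sup_add_finrank_inf_eq H1 H2
    rw [hdis, finrank_bot, add_zero] at hsum
    have hle : finrank (ZMod 2) ↥(H1 ⊔ H2) ≤ finrank (ZMod 2) ↥base.virtualKernel := Submodule.finrank_mono (sup_le h1le h2le)
    rw [hsum, (LinearEquiv.finrank_eq (Submodule.equivMapOfInjective _ LinearMap.inl_injective E1)).symm,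
      (LinearEquiv.finrank_eq (Submodule.equivMapOfInjective _ LinearMap.inr_injective E)).symm, hE1eq] at hle
    omega
  have hEτ : finrank (ZMod 2) ↥E + 1 ≤ (finrank (ZMod 2) ↥base.virtualKernel + 1) / 2 := by omega
  -- elements of `𝒦⁺(1)`
  -- (h1): the `V×0` section equals `{(x,0) ∈ 𝒦}`
  have hP1 : base.augKernel δ ⊓ LinearMap.ker (LinearMap.snd (ZMod 2) (Fin (k + 1) → ZMod 2) (Fin (k + 1) → ZMod 2)) ≤
      base.virtualKernel ⊓ LinearMap.ker (LinearMap.snd (ZMod 2) (Fin (k + 1) → ZMod 2) (Fin (k + 1) → ZMod 2)) := by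
    intro p hp
    obtain ⟨hpA, hp0⟩ := Submodule.mem_inf.1 hp
    obtain ⟨q, hq, γ, rfl⟩ := exists_of_mem_augKernel base δ hpA
    refine Submodule.mem_inf.2 ⟨?_, hp0⟩
    rw [LinearMap.mem_ker, LinearMap.snd_apply] at hp0
    -- `q.2 = γ·1`; if `γ = 1` then `L q.1 = d`, impossible; so `γ = 0`
    have hq2 : ∀ b, q.2 b = γ := fun b => by
      have := congrFun hp0 b
      simp only [Prod.snd_add, Prod.smul_snd, Pi.add_apply, Pi.smul_apply, smul_eq_mul, mul_one, Pi.zero_apply] at this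
      linear_combination this - h2 γ
    obtain ⟨hE1q, hE2q⟩ := (memK q).1 hq
    by_cases hγ : γ = 0
    · rw [hγ, zero_smul, add_zero]; exact hq
    · exfalso
      have hγ1 : γ = 1 := by
        rcases (by decide : ∀ x : ZMod 2, x = 0 ∨ x = 1) γ with h | h
        · exact absurd h hγ
        · exact h
      apply hnotim q.1
      intro i
      have e := hE1q i
      rw [hq2 i, hγ1, mul_one] at e
      linear_combination e - h2 (bz (negTwo (base.cls i)))
  -- (h2): the `0×V` section lies in `0 × (E ⊕ ⟨1⟩)`
  have hP2 : base.augKernel δ ⊓ LinearMap.ker (LinearMap.fst (ZMod 2) (Fin (k + 1) → ZMod 2) (Fin (k + 1) → ZMod 2)) ≤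
      E1.map (LinearMap.inr (ZMod 2) (Fin (k + 1) → ZMod 2) (Fin (k + 1) → ZMod 2)) := by
    intro p hp
    obtain ⟨hpA, hp0⟩ := Submodule.mem_inf.1 hp
    obtain ⟨q, hq, γ, rfl⟩ := exists_of_mem_augKernel base δ hpA
    rw [LinearMap.mem_ker, LinearMap.fst_apply] at hp0
    have hq1 : ∀ b, q.1 b = γ := fun b => by
      have := congrFun hp0 b
      simp only [Prod.fst_add, Prod.smul_fst, Pi.add_apply, Pi.smul_apply, smul_eq_mul, mul_one, Pi.zero_apply, hδdef] at this
      linear_combination this - h2 γ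
    obtain ⟨hE1q, hE2q⟩ := (memK q).1 hq
    have hq2E : q.2 ∈ E := by
      rw [memE]
      refine ⟨hE2q, fun i => ?_⟩
      have e := hE1q i
      simp only [hq1, h2, mul_zero, Finset.sum_const_zero, zero_add] at e
      exact e
    refine Submodule.mem_map.2 ⟨fun b => q.2 b + γ, ?_, ?_⟩
    · rw [hE1]; exact Submodule.add_mem_sup hq2E (Submodule.mem_span_singleton.2 ⟨γ, by funext b; simp⟩)
    · refine Prod.ext ?_ ?_
      · funext b; have := hq1 b; simp [hδdef, this, h2]
      · funext b; simp
  -- (h3): the diagonal section lies in `{(x,x) : x ∈ E ⊕ ⟨1⟩}`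
  have hP3 : base.augKernel δ ⊓ LinearMap.ker (LinearMap.fst (ZMod 2) (Fin (k + 1) → ZMod 2) (Fin (k + 1) → ZMod 2) +
      LinearMap.snd (ZMod 2) (Fin (k + 1) → ZMod 2) (Fin (k + 1) → ZMod 2)) ≤
      E1.map ((LinearMap.id : (Fin (k + 1) → ZMod 2) →ₗ[ZMod 2] (Fin (k + 1) → ZMod 2)).prod LinearMap.id) := by
    intro p hp
    obtain ⟨hpA, hp0⟩ := Submodule.mem_inf.1 hp
    obtain ⟨q, hq, γ, rfl⟩ := exists_of_mem_augKernel base δ hpA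
    rw [LinearMap.mem_ker, LinearMap.add_apply, LinearMap.fst_apply, LinearMap.snd_apply] at hp0
    have hq12 : ∀ b, q.2 b = q.1 b := fun b => by
      have := congrFun hp0 b
      simp only [Prod.fst_add, Prod.snd_add, Prod.smul_fst, Prod.smul_snd, Pi.add_apply, Pi.smul_apply, smul_eq_mul, mul_one,
        Pi.zero_apply, hδdef] at this
      linear_combination this - h2 (q.1 b) - h2 γ
    obtain ⟨hE1q, hE2q⟩ := (memK q).1 hq
    have hq1E : q.1 ∈ E := by
      rw [memE]
      have hL : ∀ i, (∑ j, bz (base.neg i j) * (q.1 j + q.1 i)) = 0 := fun i => by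
        have e := hE2q i; simp only [hq12] at e; exact e
      refine ⟨hL, fun i => ?_⟩
      have e := hE1q i
      rw [hL i, hq12 i, zero_add] at e
      exact e
    refine Submodule.mem_map.2 ⟨fun b => q.1 b + γ, ?_, ?_⟩
    · rw [hE1]; exact Submodule.add_mem_sup hq1E (Submodule.mem_span_singleton.2 ⟨γ, by funext b; simp⟩)
    · refine Prod.ext ?_ ?_
      · funext b; simp [hδdef]
      · funext b; simp [hq12 b]
  have hinjD : Function.Injective ((LinearMap.id : (Fin (k + 1) → ZMod 2) →ₗ[ZMod 2] (Fin (k + 1) → ZMod 2)).prod LinearMap.id) :=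
    fun a b hab => congrArg Prod.fst hab
  have b1 := (Submodule.finrank_mono hP1).trans ha
  have b2 := ((Submodule.finrank_mono hP2).trans
    (le_of_eq (LinearEquiv.finrank_eq (Submodule.equivMapOfInjective _ LinearMap.inr_injective E1)).symm)).trans (hE1fin.trans hEτ)
  have b3 := ((Submodule.finrank_mono hP3).trans
    (le_of_eq (LinearEquiv.finrank_eq (Submodule.equivMapOfInjective _ hinjD E1)).symm)).trans (hE1fin.trans hEτ)
  have hdim : finrank (ZMod 2) ↥(base.augKernel δ) = 2 * ((finrank (ZMod 2) ↥base.virtualKernel + 1) / 2) := by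
    rw [finrank_augKernel_eq base δ hleg, hr]; omega
  exact ⟨hleg, hdim, b1, b2, b3⟩

/-- ★★★ **ODD DESIGN ON THE FAMILY `P_b ≡ 1, 5 (mod 8)`** (`n₀ ≡ 5 (mod 8)`, no prime `≡ 3 (mod 4)` — outside THEOREM B's μ = 1): if
`dim{(x,0) ∈ 𝒦} ≤ τ₀` then `δ = 1` yields a pattern-free Heegner recipe with `τ₀ + 1` auxiliary primes (odd THEOREM A, p742384, all five
hypotheses discharged). [cite: HeathBrown1994SelmerCongruentII, Appendix (Monsky), typescript pp. 39–41] -/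
theorem exists_patternFree_design_of_negNegOne_false (hm : ∀ b, negNegOne (base.cls b) = false)
    (hd : (∑ b, bz (negTwo (base.cls b))) = 1)
    (ha : finrank (ZMod 2) ↥(base.virtualKernel ⊓
      LinearMap.ker (LinearMap.snd (ZMod 2) (Fin (k + 1) → ZMod 2) (Fin (k + 1) → ZMod 2))) ≤
        (finrank (ZMod 2) ↥base.virtualKernel + 1) / 2) :
    ∃ (c₁ : AuxCell) (rest : List AuxCell), rest.length = (finrank (ZMod 2) ↥base.virtualKernel + 1) / 2 ∧
      heegnerK base (c₁ :: rest) = true ∧ ∀ pat : ℕ → ℕ → Bool, (dataK base (c₁ :: rest) pat).monskyOddS.det = 1 := by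
  obtain ⟨hδ, hdim, h1, h2, h3⟩ := augKernel_one_hypotheses_of_negNegOne_false base hm hd ha
  exact exists_patternFree_design base _ _ hδ hdim h1 h2 h3

/-- ★★★ **The odd one-stage door on the family `P_b ≡ 1, 5 (mod 8)` is OPEN IFF the horizontal kernel pairs fit.** For such a base
(`Σ_b [(2/P_b) = −1] = 1` in `𝔽₂`, no prime `≡ 3 (mod 4)`): SOME `(δ, τ)` satisfies the five hypotheses of THEOREM A `exists_patternFree_design`
iff `dim{(x, 0) ∈ 𝒦} ≤ τ₀ = (dim 𝒦 + 1)/2` — and then `δ = 1`, `τ = τ₀` works. (`→`: `𝒦 ∩ (V×0) ⊆ 𝒦⁺(δ) ∩ (V×0)` for every δ, plus the kernel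
parity; in graph terms `𝒦 ∩ (V×0) = ker L × 0` with `L` the Laplacian of the residue graph, so the door is shut exactly when the symmetric
Laplacian has too large a kernel.) [cite: HeathBrown1994SelmerCongruentII, Appendix (Monsky), typescript pp. 39–41] -/
theorem odd_door_iff_of_negNegOne_false (hm : ∀ b, negNegOne (base.cls b) = false)
    (hd : (∑ b, bz (negTwo (base.cls b))) = 1) :
    (∃ (δ : Fin (k + 1) → ZMod 2) (τ : ℕ),
      ((δ, fun _ => (1 : ZMod 2)) : (Fin (k + 1) → ZMod 2) × (Fin (k + 1) → ZMod 2)) ∉ base.virtualKernel ∧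
      finrank (ZMod 2) ↥(base.augKernel δ) = 2 * τ ∧
      finrank (ZMod 2) ↥(base.augKernel δ ⊓
        LinearMap.ker (LinearMap.snd (ZMod 2) (Fin (k + 1) → ZMod 2) (Fin (k + 1) → ZMod 2))) ≤ τ ∧
      finrank (ZMod 2) ↥(base.augKernel δ ⊓
        LinearMap.ker (LinearMap.fst (ZMod 2) (Fin (k + 1) → ZMod 2) (Fin (k + 1) → ZMod 2))) ≤ τ ∧
      finrank (ZMod 2) ↥(base.augKernel δ ⊓ LinearMap.ker (LinearMap.fst (ZMod 2) (Fin (k + 1) → ZMod 2) (Fin (k + 1) → ZMod 2) +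
        LinearMap.snd (ZMod 2) (Fin (k + 1) → ZMod 2) (Fin (k + 1) → ZMod 2))) ≤ τ) ↔
    finrank (ZMod 2) ↥(base.virtualKernel ⊓
      LinearMap.ker (LinearMap.snd (ZMod 2) (Fin (k + 1) → ZMod 2) (Fin (k + 1) → ZMod 2))) ≤
        (finrank (ZMod 2) ↥base.virtualKernel + 1) / 2 := by
  constructor
  · rintro ⟨δ, τ, hδ, hdim, h1, -, -⟩
    have hτ : τ = (finrank (ZMod 2) ↥base.virtualKernel + 1) / 2 := by
      have e := finrank_augKernel_eq base δ hδ
      rw [hdim] at e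
      omega
    rw [← hτ]
    refine (Submodule.finrank_mono ?_).trans h1
    intro p hp
    obtain ⟨hpK, hp0⟩ := Submodule.mem_inf.1 hp
    refine Submodule.mem_inf.2 ⟨?_, hp0⟩
    unfold SymbData.augKernel
    exact Submodule.mem_sup_left hpK
  · intro ha
    obtain ⟨hδ, hdim, h1, h2, h3⟩ := augKernel_one_hypotheses_of_negNegOne_false base hm hd ha
    exact ⟨fun _ => 1, _, hδ, hdim, h1, h2, h3⟩

end OddClassesOneFive

end Summit.BirchSwinnertonDyer.BirchSwinnertonDyer.Theorems.SymbolicMonsky
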